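import Summits.BirchSwinnertonDyer.BirchSwinnertonDyer.Theorems.GenusKolyvaginAtTwoGenusDeepSupplyAtTwoNegDiscNarrowKFourCellShaCardCurrency
import HarnessLib

/-!
# Route `GenusKolyvaginAtTwo`, crux K₄ `K4Neg` (stmt-BirchSwinnertonDyer-31526) — ON THE CUT A SQUARE-FREE WITNESS IS NO WEAKER THAN A PRIME ONE:
# K4Neg's conclusion (`∃` square-free `n`) ⟹ a single deep `FrobEqFrobInfty` Kolyvagin prime `ℓ` with a `d₁`-compatible datum and `P(ℓ) ∉ 2E(K[ℓ])`

LEAD seat `bsd-line-gk2-p1` g24 (cell `bsd-f1-sign2`), `--supports stmt-BirchSwinnertonDyer-31526 --as helper`.  THEOREMS ONLY (no definition, no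
named fact, no `sorry`).  **BSD is NOT proved by this file; K4Neg is NOT proved; nothing is closed.**

WHY.  K4Neg's «why it might fail» keeps `∃ square-free n` because «forced `c_ℓ = 2` of the genus pair at every `FrobEqFrobInfty` prime may kill prime `n`
on sub-cells».  On the multiplicative cut, modulo Q2, this worry is VOID: a square-free witness gives `#Ш(E/ℚ)[2^∞] = 4^(M₀)` (p773559 §1), hence a Selmer
class over `ℚ` not killed by `2^(M₀−1)` (else CTQ + RANKQ bound `#Ш(E/ℚ)[2^∞] ∣ 4^(M₀−1)`), and B2Q♭ (gk2-p5 g36,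
`exists_frobEqFrobInfty_primitive_of_two_pow_pred_smul_ne_zero_of_Δ_neg`, p771204) turns that class into a PRIME-level witness `ℓ` whose datum is
`d₁`-COMPATIBLE (McCallum's restriction compatibilities) — more than the item asks.
* `exists_prime_witness_of_pow_dvd_natCard_sha_rat` — `4^(M₀) ∣ #Ш(E/ℚ)[2^∞]` ⟹ prime-level compatible witness;
* `exists_prime_witness_of_kFourNeg_witness` — K4Neg's conclusion ⟹ prime-level compatible witness.
So the pen may read 31526 with `n` PRIME (and `d` compatible with `d₁`) at no cost on the cut.  BSD is NOT proved by any of this.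

References: [McCallumLMS1991] §5 Lemma 5.3, Thm. 5.4; [Kolyvagin1989Izv] Thm. B₂; [Kolyvagin1991MathAnn] Thm. 1; [GrossLMS1991] §4 (4.4)–(4.6).
-/

set_option autoImplicit false
-- the Theorems namespace of this sub repeats the summit name by design (D-0017 nested layout)
set_option linter.dupNamespace false

noncomputable section

open scoped Classical
open scoped AddSubgroup

namespace Summit.BirchSwinnertonDyer.BirchSwinnertonDyer.Theorems.GenusSupplyNarrow.KFourCell.ShaCardCurrency

open WeierstrassCurve NumberField IsDedekindDomain Field Literature.NumberTheory.EllipticCurves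
  Literature.NumberTheory.GaloisRepresentations Literature.NumberTheory.EllipticCurves.ModularForms AddSubgroup
open Summit.BirchSwinnertonDyer.BirchSwinnertonDyer.Theses.GenusKolyvaginAtTwo (KolyvaginRelationAtTwo)
open Summit.BirchSwinnertonDyer.BirchSwinnertonDyer.Theorems.GenusExact.PlusDescent

/-- **`2^(2·M₀) ∣ #Ш(E/ℚ)[2^∞]` ⟹ a PRIME-level, `d₁`-compatible deep witness** on K4Neg's frame (binders VERBATIM) + one odd multiplicative prime + Q2:
a Zhang–Kolyvagin prime `ℓ` at `2` of index `≥ 2` with `FrobEqFrobInfty W K 2 ℓ`, and a datum `d` of conductor `1·ℓ` whose `σ`'s and embedding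
restrict to `d₁`'s, with `P(1·ℓ) ∉ 2E(K[1·ℓ])`.  (Some Selmer class over `ℚ` survives `2^(M₀−1)`, else `#Ш(E/ℚ)[2^∞] ∣ 4^(M₀−1)` by Kummer + CTQ +
RANKQ; then B2Q♭.)  BSD is NOT proved by this; K4Neg is NOT proved by this.
[cite: McCallumLMS1991, §5 Lemma 5.3, Thm. 5.4] [cite: Kolyvagin1989Izv, Thm. B₂] [cite: GrossLMS1991, §4 (4.4)–(4.6)] -/
theorem exists_prime_witness_of_pow_dvd_natCard_sha_rat (hQ2 : KolyvaginRelationAtTwo)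
    (W : WeierstrassCurve ℚ) [W.IsElliptic] [W.IsGloballyMinimal] [NeZero (W.conductorNorm ℤ)] (hcm : ¬ W.HasCM)
    (hr0 : W.analyticRank = 0) (hρ : ∀ n : ℕ, 0 < n → W.HasSurjectiveModNGaloisRep ((2 : ℤ) ^ n)) (hT : Odd W.tamagawaProduct)
    (hneg : W.Δ < 0) (_h4 : Nat.card (W.selmerGroup 2) = 4)
    (K : Type) [Field K] [NumberField K] (hIQ : IsImaginaryQuadratic K) (hodd : Odd (NumberField.discr K))
    (h3 : NumberField.discr K ≠ -3) (hHe : SatisfiesHeegnerHypothesis (W.conductorNorm ℤ) K)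
    (hsq1 : ¬ IsSquare ((NumberField.discr K : ℚ) * -|W.Δ|)) (hsq2 : ¬ IsSquare ((NumberField.discr K : ℚ) * (-(2 * |W.Δ|))))
    (_ℓ₀ : ℕ) (_hℓ₀ : _ℓ₀.Prime) (_hdK : NumberField.discr K = -(_ℓ₀ : ℤ))
    (_h2K : ((Ideal.span {(2 : ℤ)}).primesOver (𝓞 K)).ncard = 2)
    (Dt : ModularParametrizationData W (W.conductorNorm ℤ))
    (_hopt : ∀ z ∈ Dt.L.lattice, ∃ w ∈ periodLattice Dt.f, z = (Dt.c : ℂ) * w) (_hc : Odd Dt.c)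
    (β : ℤ) (ι : K →+* ℂ) (d₁ : KolyvaginHeegnerData Dt β ι 1) (_hy : ¬ IsOfFinAddOrder d₁.derivedPoint) (M₀ : ℕ)
    (_hdiv : ∃ Q : (W.baseChange (ringClassField K ι 1)).toAffine.Point, ((2 ^ M₀ : ℕ) : ℤ) • Q = d₁.derivedPoint)
    (hndiv : ¬ ∃ Q : (W.baseChange (ringClassField K ι 1)).toAffine.Point, ((2 ^ (M₀ + 1) : ℕ) : ℤ) • Q = d₁.derivedPoint)
    (hM₀ : 1 ≤ M₀) (Wd : WeierstrassCurve ℚ) [Wd.IsElliptic] [Wd.IsGloballyMinimal]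
    (hWd : ∃ C : VariableChange ℚ, C • W.quadraticTwist (NumberField.discr K : ℚ) = Wd) (_hrd : Wd.analyticRank = 1)
    (hSel : Nat.card (Wd.selmerGroup 2) = 2) (hDEF : padicValNat 2 Wd.tamagawaProduct ≤ 1)
    (v : HeightOneSpectrum (𝓞 ℚ)) (h2v : ((2 : ℕ) : 𝓞 ℚ) ∉ v.asIdeal) (hNv : ((W.conductorNorm ℤ : ℕ) : 𝓞 ℚ) ∈ v.asIdeal)
    (hmult : W.HasMultiplicativeReductionAt v)
    (hSha : 2 ^ (2 * M₀) ∣ Nat.card (AddCommGroup.primaryComponent W.sha 2)) :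
    ∃ (ℓ : ℕ) (d : KolyvaginHeegnerData Dt β ι (1 * ℓ)),
      Zhang2014.IsKolyvaginPrime (W.conductorNorm ℤ) W K 2 ℓ ∧ 2 ≤ Zhang2014.kolyvaginIndex W 2 ℓ ∧ FrobEqFrobInfty W K 2 ℓ ∧
      (∀ s ∈ d₁.S, ∃ s' ∈ d.S, ∀ (x : ringClassField K ι 1) (x' : ringClassField K ι (1 * ℓ)),
          (x : ℂ) = x' → ((s' x' : ringClassField K ι (1 * ℓ)) : ℂ) = (s x : ℂ)) ∧
      (∀ (x : ringClassField K ι 1) (x' : ringClassField K ι (1 * ℓ)), (x : ℂ) = x' → d.emb x' = d₁.emb x) ∧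
      ¬ ∃ Q : (W.baseChange (ringClassField K ι (1 * ℓ))).toAffine.Point, (2 : ℤ) • Q = d.derivedPoint := by
  haveI : Fact (Nat.Prime 2) := ⟨Nat.prime_two⟩
  have hw : W.rootNumber = 1 :=
    (Literature.Barriers.BirchSwinnertonDyer.even_analyticRank_iff_of_isNewformOf_conductorLevel Dt.isNewformOf).mp
      (by rw [hr0]; exact Even.zero)
  -- some Selmer class over `ℚ` survives `2^(M₀-1)`
  by_cases hsharp : ∃ (M : ℕ) (s₀ : galH1Torsion W ((2 ^ M : ℕ) : ℤ)), s₀ ∈ selmerGroup W ((2 ^ M : ℕ) : ℤ) ∧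
      ((2 ^ (M₀ - 1) : ℕ) : ℤ) • s₀ ≠ 0
  · obtain ⟨M, s₀, hs₀, hne⟩ := hsharp
    exact exists_frobEqFrobInfty_primitive_of_two_pow_pred_smul_ne_zero_of_Δ_neg hQ2 W hcm hneg hT v h2v hNv hmult K hIQ hodd h3 hHe hsq1 hsq2
      hρ Dt β ι d₁ M₀ hndiv hw M s₀ hs₀ hne
  · exfalso
    push Not at hsharp
    -- then `2^(M₀-1)` kills `Ш(E/ℚ)[2^∞]` (Kummer surjection) and CTQ + RANKQ bound its order by `4^(M₀-1)`
    have hB2Q : ∀ (k : ℕ) (a : W.galH1), a ∈ W.sha → ((2 ^ k : ℕ) : ℤ) • a = 0 → ((2 ^ (M₀ - 1) : ℕ) : ℤ) • a = 0 := by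
      intro k a ha hka
      rcases Nat.eq_zero_or_pos k with rfl | hkpos
      · rw [pow_zero, Nat.cast_one, one_zsmul] at hka
        rw [hka, zsmul_zero]
      · have hn : ((2 ^ k : ℕ) : ℤ) ≠ 0 := by positivity
        have hmem : a ∈ W.sha ⊓ torsionBy W.galH1 ((2 ^ k : ℕ) : ℤ) :=
          AddSubgroup.mem_inf.mpr ⟨ha, by change ((2 ^ k : ℕ) : ℤ) • a = 0; exact hka⟩
        rw [← WeierstrassCurve.map_torsionH1ToH1_selmerGroup_holds W hn] at hmem
        obtain ⟨x, hx, rfl⟩ := AddSubgroup.mem_map.mp hmem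
        rw [← map_zsmul, hsharp k x hx, map_zero]
    have hexp : ∀ x ∈ AddCommGroup.primaryComponent W.sha 2, 2 ^ (M₀ - 1) • x = 0 :=
      forall_primaryComponent_sha_two_pow_smul_eq_zero_of_galH1 W hB2Q
    have h4 : Nat.card (AddSubgroup.torsionBy W.sha ((2 : ℕ) : ℤ)) ≤ 4 := by
      have h := natCard_sha_torsionBy_two_dvd_four_of_genusBudget_le_one_unramified W hneg hT hIQ hodd hHe Wd hWd hDEF hSel
      exact Nat.le_of_dvd (by norm_num) (by simpa using h)
    have hdvd := natCard_primaryComponent_sha_rat_two_dvd_of_exponent_of_card_sha_two_torsion_le_onHabitat hQ2 W hcm hT v h2v hNv hmult hneg K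
      hIQ hodd h3 hHe hsq1 hsq2 hρ Dt β ι d₁ M₀ hndiv hexp h4
    have hle : 2 * M₀ ≤ 2 * (M₀ - 1) := (Nat.pow_dvd_pow_iff_le_right (by norm_num : 1 < 2)).mp (hSha.trans hdvd)
    omega

/-- **K4Neg's conclusion (square-free `n`) ⟹ a PRIME-level, `d₁`-compatible deep witness** on K4Neg's frame + one odd multiplicative prime + Q2
(via `#Ш(E/ℚ)[2^∞] = 4^(M₀)`, p773559 §1, and the previous theorem): on the cut a composite level never helps.  BSD is NOT proved by this; K4Neg is
NOT proved by this. [cite: McCallumLMS1991, §5 Thm. 5.4] [cite: Kolyvagin1991MathAnn, Thm. 1] [cite: Kolyvagin1989Izv, Thm. B₂] -/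
theorem exists_prime_witness_of_kFourNeg_witness (hQ2 : KolyvaginRelationAtTwo)
    (W : WeierstrassCurve ℚ) [W.IsElliptic] [W.IsGloballyMinimal] [NeZero (W.conductorNorm ℤ)] (hcm : ¬ W.HasCM)
    (hr0 : W.analyticRank = 0) (hρ : ∀ n : ℕ, 0 < n → W.HasSurjectiveModNGaloisRep ((2 : ℤ) ^ n)) (hT : Odd W.tamagawaProduct)
    (hneg : W.Δ < 0) (h4 : Nat.card (W.selmerGroup 2) = 4)
    (K : Type) [Field K] [NumberField K] (hIQ : IsImaginaryQuadratic K) (hodd : Odd (NumberField.discr K))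
    (h3 : NumberField.discr K ≠ -3) (hHe : SatisfiesHeegnerHypothesis (W.conductorNorm ℤ) K)
    (hsq1 : ¬ IsSquare ((NumberField.discr K : ℚ) * -|W.Δ|)) (hsq2 : ¬ IsSquare ((NumberField.discr K : ℚ) * (-(2 * |W.Δ|))))
    (ℓ₀ : ℕ) (hℓ₀ : ℓ₀.Prime) (hdK : NumberField.discr K = -(ℓ₀ : ℤ))
    (h2K : ((Ideal.span {(2 : ℤ)}).primesOver (𝓞 K)).ncard = 2)
    (Dt : ModularParametrizationData W (W.conductorNorm ℤ))
    (hopt : ∀ z ∈ Dt.L.lattice, ∃ w ∈ periodLattice Dt.f, z = (Dt.c : ℂ) * w) (hc : Odd Dt.c)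
    (β : ℤ) (ι : K →+* ℂ) (d₁ : KolyvaginHeegnerData Dt β ι 1) (hy : ¬ IsOfFinAddOrder d₁.derivedPoint) (M₀ : ℕ)
    (hdiv : ∃ Q : (W.baseChange (ringClassField K ι 1)).toAffine.Point, ((2 ^ M₀ : ℕ) : ℤ) • Q = d₁.derivedPoint)
    (hndiv : ¬ ∃ Q : (W.baseChange (ringClassField K ι 1)).toAffine.Point, ((2 ^ (M₀ + 1) : ℕ) : ℤ) • Q = d₁.derivedPoint)
    (hM₀ : 1 ≤ M₀) (Wd : WeierstrassCurve ℚ) [Wd.IsElliptic] [Wd.IsGloballyMinimal]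
    (hWd : ∃ C : VariableChange ℚ, C • W.quadraticTwist (NumberField.discr K : ℚ) = Wd) (hrd : Wd.analyticRank = 1)
    (hSel : Nat.card (Wd.selmerGroup 2) = 2) (hDEF : padicValNat 2 Wd.tamagawaProduct ≤ 1)
    (v : HeightOneSpectrum (𝓞 ℚ)) (h2v : ((2 : ℕ) : 𝓞 ℚ) ∉ v.asIdeal) (hNv : ((W.conductorNorm ℤ : ℕ) : 𝓞 ℚ) ∈ v.asIdeal)
    (hmult : W.HasMultiplicativeReductionAt v)
    (hK4 : ∃ (n : ℕ) (d : KolyvaginHeegnerData Dt β ι n), Squarefree n ∧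
      (∀ ℓ ∈ n.primeFactors, Zhang2014.IsKolyvaginPrime (W.conductorNorm ℤ) W K 2 ℓ ∧ 2 ≤ Zhang2014.kolyvaginIndex W 2 ℓ ∧
        FrobEqFrobInfty W K 2 ℓ) ∧
      ¬ ∃ Q : (W.baseChange (ringClassField K ι n)).toAffine.Point, (2 : ℤ) • Q = d.derivedPoint) :
    ∃ (ℓ : ℕ) (d : KolyvaginHeegnerData Dt β ι (1 * ℓ)),
      Zhang2014.IsKolyvaginPrime (W.conductorNorm ℤ) W K 2 ℓ ∧ 2 ≤ Zhang2014.kolyvaginIndex W 2 ℓ ∧ FrobEqFrobInfty W K 2 ℓ ∧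
      (∀ s ∈ d₁.S, ∃ s' ∈ d.S, ∀ (x : ringClassField K ι 1) (x' : ringClassField K ι (1 * ℓ)),
          (x : ℂ) = x' → ((s' x' : ringClassField K ι (1 * ℓ)) : ℂ) = (s x : ℂ)) ∧
      (∀ (x : ringClassField K ι 1) (x' : ringClassField K ι (1 * ℓ)), (x : ℂ) = x' → d.emb x' = d₁.emb x) ∧
      ¬ ∃ Q : (W.baseChange (ringClassField K ι (1 * ℓ))).toAffine.Point, (2 : ℤ) • Q = d.derivedPoint :=
  exists_prime_witness_of_pow_dvd_natCard_sha_rat hQ2 W hcm hr0 hρ hT hneg h4 K hIQ hodd h3 hHe hsq1 hsq2 ℓ₀ hℓ₀ hdK h2K Dt hopt hc β ι d₁ hy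
    M₀ hdiv hndiv hM₀ Wd hWd hrd hSel hDEF v h2v hNv hmult
    (by rw [natCard_sha_rat_two_eq_pow_of_kFourNeg_witness hQ2 W hcm hr0 hρ hT hneg h4 K hIQ hodd h3 hHe hsq1 hsq2 ℓ₀ hℓ₀ hdK h2K Dt hopt hc β
      ι d₁ hy M₀ hdiv hndiv hM₀ Wd hWd hrd hSel hDEF v h2v hNv hmult hK4])

end Summit.BirchSwinnertonDyer.BirchSwinnertonDyer.Theorems.GenusSupplyNarrow.KFourCell.ShaCardCurrency

end
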